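import Summits.Ventures.PercRepro.PairCert

/-!
# The two-edge HUB certificate for Lemma 5 (p6, gen 6)

The shape of the exact certificate found for the hub-split gadget (`proofs/P6-classlevel.md` §6), in
general form: fix two free edges `s₁ ≠ s₂` (the hub set `S = {s₁, s₂}`) and write `N I U` for the nested
sums of `ForceSet.lean` over `S` (polynomials in the other weights). If

* the four DIAGONAL classes `(∅,∅)`, `({s₁},{s₁})`, `({s₂},{s₂})`, `(S,S)` are strictly negative,
* the two single-edge classes `(∅,{s₁})`, `(∅,{s₂})` are nonpositive, and
* the BUDGET inequality holds —
  `N(∅,S)⁺² · N({s₁},{s₁}) N({s₂},{s₂}) + N({s₁},S)⁺² · N(∅,∅) N({s₂},{s₂}) + N({s₂},S)⁺² · N(∅,∅) N({s₁},{s₁})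
     ≤ 4 · N(∅,∅) N(S,S) N({s₁},{s₁}) N({s₂},{s₂})`
  (`x⁺ = max x 0`; every product on both sides is positive),

then `Q⁺(Δ_g, Δ_g) ≤ 0`. Proof: `deltaQuad_nonpos_of_repairs` with the three mixed classes `(I, S)` as the
negative classes (those that are positive at `p`), partners `(I, I)` and `(S, S)`, share `1` of `(I, I)` and
the share `θ_I = N(I,S)⁺² / (4 N(I,I) N(S,S))` of the common partner `(S, S)`; the budget says `Σ θ ≤ 1`.
The strictness of the four diagonal classes holds in the open cube whenever each has a negative fine
coefficient; the closed cube follows by continuity (not formalised here).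

* `mem_powerset_pair`, `deltaQuad_nonpos_of_hubBudget`.
-/

namespace PercRepro

open Finset

/-- The subsets of a pair. -/
theorem mem_powerset_pair {E : Type*} [DecidableEq E] {s₁ s₂ : E} {J : Finset E}
    (hJ : J ∈ ({s₁, s₂} : Finset E).powerset) : J = ∅ ∨ J = {s₁} ∨ J = {s₂} ∨ J = {s₁, s₂} := by
  have hJ' : J ⊆ {s₁, s₂} := Finset.mem_powerset.mp hJ
  rw [Finset.subset_insert_iff, Finset.subset_singleton_iff] at hJ'
  by_cases h1 : s₁ ∈ J
  · rcases hJ' with h | h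
    · right; left
      ext x
      constructor
      · intro hx
        by_cases hx1 : x = s₁
        · simp [hx1]
        · exfalso
          have : x ∈ J.erase s₁ := Finset.mem_erase.mpr ⟨hx1, hx⟩
          simp [h] at this
      · intro hx
        simp only [Finset.mem_singleton] at hx
        subst hx
        exact h1
    · right; right; right
      rw [← Finset.insert_erase h1, h]
  · rw [Finset.erase_eq_of_notMem h1] at hJ'
    rcases hJ' with h | h
    · exact Or.inl h
    · exact Or.inr (Or.inr (Or.inl h))

namespace MultiGraph

variable {V E : Type*} [DecidableEq E] [Fintype E] (G : MultiGraph V E)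

open Classical in
/-- **Lemma 5 from a two-edge hub certificate.** -/
theorem deltaQuad_nonpos_of_hubBudget {p : E → ℝ} (hp : IsProb p) {s₁ s₂ g : E} (hne : s₁ ≠ s₂)
    (hg₁ : g ≠ s₁) (hg₂ : g ≠ s₂) (a b c d : V)
    (h00 : G.nestedSum p {s₁, s₂} g a b c d ∅ ∅ < 0)
    (h11 : G.nestedSum p {s₁, s₂} g a b c d {s₁} {s₁} < 0)
    (h22 : G.nestedSum p {s₁, s₂} g a b c d {s₂} {s₂} < 0)
    (hSS : G.nestedSum p {s₁, s₂} g a b c d {s₁, s₂} {s₁, s₂} < 0)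
    (h01 : G.nestedSum p {s₁, s₂} g a b c d ∅ {s₁} ≤ 0)
    (h02 : G.nestedSum p {s₁, s₂} g a b c d ∅ {s₂} ≤ 0)
    (hbudget :
      (max (G.nestedSum p {s₁, s₂} g a b c d ∅ {s₁, s₂}) 0) ^ 2 *
          (G.nestedSum p {s₁, s₂} g a b c d {s₁} {s₁} * G.nestedSum p {s₁, s₂} g a b c d {s₂} {s₂}) +
        (max (G.nestedSum p {s₁, s₂} g a b c d {s₁} {s₁, s₂}) 0) ^ 2 *
          (G.nestedSum p {s₁, s₂} g a b c d ∅ ∅ * G.nestedSum p {s₁, s₂} g a b c d {s₂} {s₂}) +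
        (max (G.nestedSum p {s₁, s₂} g a b c d {s₂} {s₁, s₂}) 0) ^ 2 *
          (G.nestedSum p {s₁, s₂} g a b c d ∅ ∅ * G.nestedSum p {s₁, s₂} g a b c d {s₁} {s₁}) ≤
      4 * (G.nestedSum p {s₁, s₂} g a b c d ∅ ∅ * G.nestedSum p {s₁, s₂} g a b c d {s₁, s₂} {s₁, s₂} *
        G.nestedSum p {s₁, s₂} g a b c d {s₁} {s₁} * G.nestedSum p {s₁, s₂} g a b c d {s₂} {s₂})) :
    G.deltaQuad p g a b c d ≤ 0 := by
  set S : Finset E := {s₁, s₂} with hS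
  set N : Finset E → Finset E → ℝ := G.nestedSum p S g a b c d with hN
  have hg : g ∉ S := by simp [hS, hg₁, hg₂]
  have h1S : ({s₁} : Finset E) ≠ S := by
    intro h; have : s₂ ∈ ({s₁} : Finset E) := h ▸ (by simp [hS]); simp at this; exact hne this.symm
  have h2S : ({s₂} : Finset E) ≠ S := by
    intro h; have : s₁ ∈ ({s₂} : Finset E) := h ▸ (by simp [hS]); simp at this; exact hne this
  have h0S : (∅ : Finset E) ≠ S := by
    intro h
    have h' : s₁ ∈ (∅ : Finset E) := by rw [h]; simp [hS]
    simp at h'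
  have h12 : ({s₁} : Finset E) ≠ {s₂} := by simpa using hne
  -- the three mixed classes
  set three : Finset (Finset E × Finset E) := {(∅, S), ({s₁}, S), ({s₂}, S)} with hthree
  set neg : Finset (Finset E × Finset E) := three.filter (fun C => 0 < N C.1 C.2) with hneg
  -- shares
  set θ : Finset E × Finset E → ℝ := fun C => (max (N C.1 C.2) 0) ^ 2 / (4 * N C.1 C.1 * N S S) with hθ
  set sh : Finset E × Finset E → Finset E → ℝ := fun C J =>
    if J = S then max (θ C) 0 else if J = C.1 then 1 else 0 with hsh
  have hmem_three : ∀ C ∈ three, C = (∅, S) ∨ C = ({s₁}, S) ∨ C = ({s₂}, S) := by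
    intro C hC; simpa [hthree] using hC
  have hmem_neg : ∀ C ∈ neg, (C = (∅, S) ∨ C = ({s₁}, S) ∨ C = ({s₂}, S)) ∧ 0 < N C.1 C.2 := by
    intro C hC; have := Finset.mem_filter.mp hC; exact ⟨hmem_three C this.1, this.2⟩
  have hdiagneg : ∀ C ∈ three, N C.1 C.1 < 0 := by
    intro C hC; rcases hmem_three C hC with rfl | rfl | rfl <;> simpa [hN] using (by assumption : _)
  -- the common denominators are positive
  have hD : ∀ C ∈ three, 0 < 4 * N C.1 C.1 * N S S := by
    intro C hC; have := hdiagneg C hC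
    have hSS' : N S S < 0 := by simpa [hN, hS] using hSS
    nlinarith [mul_pos_of_neg_of_neg this hSS']
  have hθnn : ∀ C ∈ three, 0 ≤ θ C := fun C hC => div_nonneg (sq_nonneg _) (hD C hC).le
  refine G.deltaQuad_nonpos_of_repairs hp hg a b c d neg ?_ (fun C => C.1) (fun C => C.2) sh ?_ ?_ ?_ ?_ ?_ ?_ ?_
  · -- neg ⊆ P
    intro C hC
    rcases (hmem_neg C hC).1 with rfl | rfl | rfl <;>
      exact Finset.mem_product.mpr ⟨Finset.mem_powerset.mpr (by simp [hS]), Finset.mem_powerset.mpr (by simp [hS])⟩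
  · -- partners
    intro C hC
    rcases (hmem_neg C hC).1 with rfl | rfl | rfl
    · exact ⟨by simp, by simp, by simp, Finset.Subset.refl _⟩
    · refine ⟨Finset.inter_eq_left.mpr ?_, Finset.union_eq_right.mpr ?_, ?_, Finset.Subset.refl _⟩ <;>
        simp [hS]
    · refine ⟨Finset.inter_eq_left.mpr ?_, Finset.union_eq_right.mpr ?_, ?_, Finset.Subset.refl _⟩ <;>
        simp [hS]
  · -- shares nonnegative
    intro C J; simp only [hsh]; split_ifs <;> norm_num [le_max_right]
  · -- total share ≤ 1
    intro J hJ
    by_cases hJS : J = S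
    · subst hJS
      have hsum : ∑ C ∈ neg, sh C S = ∑ C ∈ neg, max (θ C) 0 := by
        refine Finset.sum_congr rfl fun C _ => ?_; simp [hsh]
      rw [hsum]
      have hle : ∑ C ∈ neg, max (θ C) 0 ≤ ∑ C ∈ three, max (θ C) 0 :=
        Finset.sum_le_sum_of_subset_of_nonneg (Finset.filter_subset _ _) (fun C _ _ => le_max_right _ _)
      refine hle.trans ?_
      have hne1 : ((∅ : Finset E), S) ≠ ({s₁}, S) := by simp
      have hne2 : ((∅ : Finset E), S) ≠ ({s₂}, S) := by simp
      have hne3 : (({s₁} : Finset E), S) ≠ ({s₂}, S) := by simp [h12]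
      rw [hthree, Finset.sum_insert (by simp [hne1, hne2]), Finset.sum_insert (by simp [hne3]),
        Finset.sum_singleton]
      have e0 : max (θ (∅, S)) 0 = θ (∅, S) := max_eq_left (hθnn _ (by simp [hthree]))
      have e1 : max (θ ({s₁}, S)) 0 = θ ({s₁}, S) := max_eq_left (hθnn _ (by simp [hthree]))
      have e2 : max (θ ({s₂}, S)) 0 = θ ({s₂}, S) := max_eq_left (hθnn _ (by simp [hthree]))
      rw [e0, e1, e2]
      simp only [hθ]
      have hSS' : N S S < 0 := by simpa [hN, hS] using hSS
      have h00' : N ∅ ∅ < 0 := by simpa [hN] using h00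
      have h11' : N {s₁} {s₁} < 0 := by simpa [hN] using h11
      have h22' : N {s₂} {s₂} < 0 := by simpa [hN] using h22
      have hpos : 0 < 4 * (N ∅ ∅ * N S S * N {s₁} {s₁} * N {s₂} {s₂}) := by
        have := mul_pos_of_neg_of_neg h00' hSS'
        have := mul_pos_of_neg_of_neg h11' h22'
        nlinarith
      have hb : (max (N ∅ S) 0) ^ 2 * (N {s₁} {s₁} * N {s₂} {s₂}) +
          (max (N {s₁} S) 0) ^ 2 * (N ∅ ∅ * N {s₂} {s₂}) +
          (max (N {s₂} S) 0) ^ 2 * (N ∅ ∅ * N {s₁} {s₁}) ≤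
          4 * (N ∅ ∅ * N S S * N {s₁} {s₁} * N {s₂} {s₂}) := by simpa [hN, hS] using hbudget
      have hn0 : N ∅ ∅ ≠ 0 := h00'.ne
      have hn1 : N {s₁} {s₁} ≠ 0 := h11'.ne
      have hn2 : N {s₂} {s₂} ≠ 0 := h22'.ne
      have hnS : N S S ≠ 0 := hSS'.ne
      have key : (max (N ∅ S) 0) ^ 2 / (4 * N ∅ ∅ * N S S) +
          ((max (N {s₁} S) 0) ^ 2 / (4 * N {s₁} {s₁} * N S S) +
            (max (N {s₂} S) 0) ^ 2 / (4 * N {s₂} {s₂} * N S S)) =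
          ((max (N ∅ S) 0) ^ 2 * (N {s₁} {s₁} * N {s₂} {s₂}) +
            (max (N {s₁} S) 0) ^ 2 * (N ∅ ∅ * N {s₂} {s₂}) +
            (max (N {s₂} S) 0) ^ 2 * (N ∅ ∅ * N {s₁} {s₁})) /
          (4 * (N ∅ ∅ * N S S * N {s₁} {s₁} * N {s₂} {s₂})) := by
        field_simp
        ring
      rw [key, div_le_one hpos]
      exact hb
    · have hsum : ∑ C ∈ neg, sh C J = ∑ C ∈ neg, (if J = C.1 then (1 : ℝ) else 0) := by
        refine Finset.sum_congr rfl fun C _ => ?_; simp [hsh, hJS]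
      rw [hsum]
      have hle : ∑ C ∈ neg, (if J = C.1 then (1 : ℝ) else 0) ≤
          ∑ C ∈ three, (if J = C.1 then (1 : ℝ) else 0) :=
        Finset.sum_le_sum_of_subset_of_nonneg (Finset.filter_subset _ _)
          (fun C _ _ => by split_ifs <;> norm_num)
      refine hle.trans ?_
      have hne1 : ((∅ : Finset E), S) ≠ ({s₁}, S) := by simp
      have hne2 : ((∅ : Finset E), S) ≠ ({s₂}, S) := by simp
      have hne3 : (({s₁} : Finset E), S) ≠ ({s₂}, S) := by simp [h12]
      rw [hthree, Finset.sum_insert (by simp [hne1, hne2]), Finset.sum_insert (by simp [hne3]),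
        Finset.sum_singleton]
      rcases Classical.em (J = (∅ : Finset E)) with rfl | hJ0
      · simp
      rcases Classical.em (J = {s₁}) with rfl | hJ1
      · simp [hne]
      rcases Classical.em (J = {s₂}) with rfl | hJ2
      · simp [hne.symm]
      simp [hJ0, hJ1, hJ2]
  · -- diagonal classes nonpositive
    intro J hJ
    rcases mem_powerset_pair hJ with rfl | rfl | rfl | rfl
    · exact h00.le
    · exact h11.le
    · exact h22.le
    · exact hSS.le
  · -- negative classes are off-diagonal
    intro C hC
    rcases (hmem_neg C hC).1 with rfl | rfl | rfl
    · exact h0S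
    · exact h1S
    · exact h2S
  · -- discriminants
    intro C hC
    obtain ⟨hC3, hpos⟩ := hmem_neg C hC
    have hSS' : N S S < 0 := by simpa [hN, hS] using hSS
    have hnS : N S S ≠ 0 := hSS'.ne
    rcases hC3 with rfl | rfl | rfl
    · have hpos' : 0 < N ∅ S := hpos
      have e1 : sh ((∅ : Finset E), S) ((∅ : Finset E), S).1 = 1 := by simp [hsh, h0S]
      have e2 : sh ((∅ : Finset E), S) ((∅ : Finset E), S).2 = θ ((∅ : Finset E), S) := by
        simp [hsh, max_eq_left (hθnn ((∅ : Finset E), S) (by simp [hthree]))]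
      rw [e1, e2]
      simp only [hθ, max_eq_left hpos'.le]
      have hn0 : N ∅ ∅ ≠ 0 := (by simpa [hN] using h00 : N ∅ ∅ < 0).ne
      apply le_of_eq
      field_simp
      ring
    · have hpos' : 0 < N {s₁} S := hpos
      have e1 : sh (({s₁} : Finset E), S) (({s₁} : Finset E), S).1 = 1 := by simp [hsh, h1S]
      have e2 : sh (({s₁} : Finset E), S) (({s₁} : Finset E), S).2 = θ (({s₁} : Finset E), S) := by
        simp [hsh, max_eq_left (hθnn (({s₁} : Finset E), S) (by simp [hthree]))]
      rw [e1, e2]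
      simp only [hθ, max_eq_left hpos'.le]
      have hn1 : N {s₁} {s₁} ≠ 0 := (by simpa [hN] using h11 : N {s₁} {s₁} < 0).ne
      apply le_of_eq
      field_simp
      ring
    · have hpos' : 0 < N {s₂} S := hpos
      have e1 : sh (({s₂} : Finset E), S) (({s₂} : Finset E), S).1 = 1 := by simp [hsh, h2S]
      have e2 : sh (({s₂} : Finset E), S) (({s₂} : Finset E), S).2 = θ (({s₂} : Finset E), S) := by
        simp [hsh, max_eq_left (hθnn (({s₂} : Finset E), S) (by simp [hthree]))]
      rw [e1, e2]
      simp only [hθ, max_eq_left hpos'.le]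
      have hn2 : N {s₂} {s₂} ≠ 0 := (by simpa [hN] using h22 : N {s₂} {s₂} < 0).ne
      apply le_of_eq
      field_simp
      ring
  · -- every other class
    intro IU hIU hn hnd
    by_cases hsub : IU.1 ⊆ IU.2
    · obtain ⟨hI, hU⟩ := Finset.mem_product.mp hIU
      obtain ⟨I, U⟩ := IU
      simp only at hsub hnd hn ⊢
      have hmixed : ∀ {I' U' : Finset E}, (I', U') ∈ three → (I', U') ∉ neg → N I' U' ≤ 0 :=
        fun h3 hn' => not_lt.mp fun h => hn' (Finset.mem_filter.mpr ⟨h3, h⟩)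
      have hm0 : ((∅ : Finset E), S) ∈ three := by simp [hthree]
      have hm1 : (({s₁} : Finset E), S) ∈ three := by simp [hthree]
      have hm2 : (({s₂} : Finset E), S) ∈ three := by simp [hthree]
      rcases mem_powerset_pair (s₁ := s₁) (s₂ := s₂) (by simpa [hS] using hI) with rfl | rfl | rfl | rfl <;>
        rcases mem_powerset_pair (s₁ := s₁) (s₂ := s₂) (by simpa [hS] using hU) with rfl | rfl | rfl | rfl
      · exact absurd rfl hnd
      · exact h01
      · exact h02
      · exact hmixed hm0 hn
      · exact absurd (@hsub s₁ (by simp)) (by simp)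
      · exact absurd rfl hnd
      · exact absurd (@hsub s₁ (by simp)) (by simp [hne])
      · exact hmixed hm1 hn
      · exact absurd (@hsub s₂ (by simp)) (by simp)
      · exact absurd (@hsub s₂ (by simp)) (by simp [hne.symm])
      · exact absurd rfl hnd
      · exact hmixed hm2 hn
      · exact absurd (@hsub s₁ (by simp)) (by simp)
      · exact absurd (@hsub s₂ (by simp)) (by simp [hne.symm])
      · exact absurd (@hsub s₁ (by simp)) (by simp [hne])
      · exact absurd rfl hnd
    · rw [G.nestedSum_eq_zero_of_not_subset p S g a b c d hsub]

end MultiGraph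

end PercRepro
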